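import Summits.MatrixMultiplication.MatrixMultiplication.Theorems.SaturationLadderTwinSaturation
import HarnessLib

/-!
# SaturationLadder — the sub-three rung `SubThreeSaturation` PROVED (base `2.97`)

Route `SaturationLadder` (sub-problem `MatrixMultiplication`), aside item `SubThreeSaturation`
(stmt-MatrixMultiplication-32679):

  `∃ θ, 0 < θ < 3 ∧ ∃ C, ∀ t ∈ [0,1), ∃ r, 1 ≤ r ≤ C · θ^{1/(1−t)} ∧ ω(1, t, r) ≤ 1 + r`

— the saturation abscissa `r(t) = inf {r ≥ 1 : ω(1,t,r) = 1 + r}` of the thin shapes `⟨n, n^t, n^r⟩`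
grows at most like `θ^{1/(1−t)}` for a base `θ` STRICTLY BELOW the twin rung's `3`
(`Theorems/SaturationLadderTwinSaturation.twinSaturation`, item 30539) and the Coppersmith–Winograd
level-1 base `4` (`Theorems/SaturationLadderExpSaturation.expSaturation_holds`, item 25913).

The certificates are the SAME exact twin-tensor points `ω(1, t_j, r_j) = 1 + r_j` along the STAGE-2
family `(n₁,…,n₆) = (30j+20, 20j·2^{j+1} − 30j − 37, 30j+37, 10j−20, 0, 20j)` of
`Theorems/SaturationLadderTwinFamily.lean` (entropy inequalities `familyX`, `j ≥ 64`, and `familyY`,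
`j ≥ 1000`, landed).  What changes is only the final real analysis: along the family
`1/(1 − t_j) = (j+1)(30j+37)/(47j+37) ≥ 30 j / 47` and `r_{j+1} ≤ 2^{j+2}`, so ANY base `θ` with
`θ^{30} ≥ 2^{47}` (i.e. `θ ≥ 2^{47/30} = 2.9622…`) dominates the growth; we take `θ = 297/100`
(`297^{30} ≥ 2^{47} · 100^{30}`, checked by `norm_num`).

* `baseSaturation_of_certificates`: the reduction of `Theorems/SaturationLadderTwinReduction.lean`
  for an ARBITRARY base `θ ≥ 1` (a sequence of saturation points whose abscissae exhaust `[0,1)` and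
  whose ordinates grow at most like `θ^{1/(1−t_k)}` gives the base-`θ` rung) — reusable by every later
  rung of the base ladder.
* `two_pow_le_rpow_297`: `2^j ≤ (297/100)^{1/(1−t_j)}`.
* `saturationBase_297`: the base-`2.97` rung with an explicit base.
* `subThreeSaturation`: **`SubThreeSaturation`** (unconditional).

No named facts, no sorry (cell `decomp-mm`, lens 1 «grading / quantitative ladder», gen 10).
-/

set_option linter.dupNamespace false
-- (single-conjunct summit: the namespace repeats `MatrixMultiplication`)

noncomputable section

namespace Summit.MatrixMultiplication.MatrixMultiplication.Theorems.SaturationLadderSubThreeSaturation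

open Literature.Computability.AlgebraicComplexity
open Summit.MatrixMultiplication.MatrixMultiplication.Theses.SaturationLadder
  (SubThreeSaturation TwinSaturation)
open Summit.MatrixMultiplication.MatrixMultiplication.Theorems.SaturationLadderExpSaturation
  (omegaRect_mono')
open Summit.MatrixMultiplication.MatrixMultiplication.Theorems.SaturationLadderTwinExact
  (omegaRect_one_tw_exact)
open Summit.MatrixMultiplication.MatrixMultiplication.Theorems.SaturationLadderTwinFamily
open Summit.MatrixMultiplication.MatrixMultiplication.Theorems.SaturationLadderTwinFamilyX
  (familyX)
open Summit.MatrixMultiplication.MatrixMultiplication.Theorems.SaturationLadderTwinSaturation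
  (familyY)

/-! ## The reduction for an arbitrary base `θ ≥ 1` -/

/-- `θ^{1/(1−·)}` is monotone on `(-∞,1)` for `θ ≥ 1`. [folklore] -/
theorem rpow_inv_mono {θ s t : ℝ} (hθ : 1 ≤ θ) (hst : s ≤ t) (ht : t < 1) :
    θ ^ (1 / (1 - s)) ≤ θ ^ (1 / (1 - t)) := by
  apply Real.rpow_le_rpow_of_exponent_le hθ
  exact one_div_le_one_div_of_le (by linarith) (by linarith)

/-- `θ ≤ θ^{1/(1−t)}` for `t ∈ [0,1)` and `θ ≥ 1`. [folklore] -/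
theorem le_rpow_inv {θ t : ℝ} (hθ : 1 ≤ θ) (ht0 : 0 ≤ t) (ht : t < 1) :
    θ ≤ θ ^ (1 / (1 - t)) := by
  have h := rpow_inv_mono hθ ht0 ht
  simpa using h

/-- **The base-`θ` rung from a sequence of exact certificates** (`θ ≥ 1`).  If `(t_k, r_k)_{k ∈ ℕ}`
satisfy `1 ≤ r_k`, `ω(1, t_k, r_k) ≤ 1 + r_k`, every `t < 1` is `≤ t_k` for some `k`, `r_0 ≤ θ C` and
`r_{k+1} ≤ C · θ^{1/(1−t_k)}`, then for every `s ∈ [0,1)` some `r ∈ [1, C · θ^{1/(1−s)}]` has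
`ω(1, s, r) ≤ 1 + r`.  (For `s ∈ (t_{k−1}, t_k]` take `r = r_k`: monotonicity of `ω(1, ·, r)` and of
`θ^{1/(1−·)}`.)  The twin reduction `twinSaturation_of_certificates` is the case `θ = 3`.
[cite: AlmanDuanVassilevskaWilliamsXuXuZhou2025, §3.4] -/
theorem baseSaturation_of_certificates (θ C : ℝ) (hθ : 1 ≤ θ) (t r : ℕ → ℝ) (hr1 : ∀ k, 1 ≤ r k)
    (hsat : ∀ k, omegaRect ℂ 1 (t k) (r k) ≤ 1 + r k) (hcov : ∀ s : ℝ, s < 1 → ∃ k, s ≤ t k)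
    (h0 : r 0 ≤ θ * C) (hstep : ∀ k, r (k + 1) ≤ C * θ ^ (1 / (1 - t k))) :
    ∀ s : ℝ, 0 ≤ s → s < 1 →
      ∃ ρ : ℝ, 1 ≤ ρ ∧ ρ ≤ C * θ ^ (1 / (1 - s)) ∧ omegaRect ℂ 1 s ρ ≤ 1 + ρ := by
  intro s hs0 hs1
  classical
  have hex : ∃ k, s ≤ t k := hcov s hs1
  have hθ0 : 0 < θ := by linarith
  -- `C ≥ 0` from `1 ≤ r_1 ≤ C θ^{…}`
  have hC : 0 ≤ C := by
    have h1 := (hr1 1).trans (hstep 0)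
    have hpow : 0 < θ ^ (1 / (1 - t 0)) := Real.rpow_pos_of_pos hθ0 _
    by_contra hneg
    rw [not_le] at hneg
    have : C * θ ^ (1 / (1 - t 0)) < 0 := mul_neg_of_neg_of_pos hneg hpow
    linarith
  -- the least index `k` with `s ≤ t_k`
  refine ⟨r (Nat.find hex), hr1 _, ?_, ?_⟩
  · -- growth: `r_k ≤ C · θ^{1/(1−s)}`
    rcases Nat.eq_zero_or_pos (Nat.find hex) with hk0 | hkpos
    · rw [hk0]
      exact h0.trans (by nlinarith [le_rpow_inv hθ hs0 hs1])
    · obtain ⟨k, hk⟩ : ∃ k, Nat.find hex = k + 1 := ⟨Nat.find hex - 1, by omega⟩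
      rw [hk]
      -- minimality: `t_k < s`
      have hlt : t k < s := by
        have := Nat.find_min hex (show k < Nat.find hex by omega)
        exact lt_of_not_ge this
      exact (hstep k).trans (mul_le_mul_of_nonneg_left (rpow_inv_mono hθ hlt.le hs1) hC)
  · -- saturation: `ω(1, s, r_k) ≤ ω(1, t_k, r_k) ≤ 1 + r_k`
    have hsk : s ≤ t (Nat.find hex) := Nat.find_spec hex
    exact (omegaRect_mono' le_rfl hsk le_rfl).trans (hsat _)

/-! ## The base `297/100` dominates the family's growth -/

/-- `2^j ≤ (297/100)^{1/(1 − t_j)}`: `1/(1−t_j) ≥ 30j/47` and `(297/100)^{30} ≥ 2^{47}`. [folklore] -/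
theorem two_pow_le_rpow_297 (j : ℕ) : (2 : ℝ) ^ j ≤ (297 / 100 : ℝ) ^ (1 / (1 - fT j)) := by
  -- exponent comparison
  have hexp : (30 : ℝ) * j / 47 ≤ 1 / (1 - fT j) := by
    rw [one_sub_fT, one_div_div]
    rw [div_le_div_iff₀ (by norm_num) (by positivity)]
    nlinarith [sq_nonneg (j : ℝ), (Nat.cast_nonneg j : (0 : ℝ) ≤ j)]
  refine le_trans ?_
    (Real.rpow_le_rpow_of_exponent_le (by norm_num : (1 : ℝ) ≤ 297 / 100) hexp)
  -- `2^j = (2^47)^{j/47} ≤ ((297/100)^30)^{j/47} = (297/100)^{30 j / 47}`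
  have h47 : ((2 : ℝ) ^ (47 : ℕ)) ≤ (297 / 100 : ℝ) ^ (30 : ℕ) := by norm_num
  have hj0 : (0 : ℝ) ≤ (j : ℝ) / 47 := by positivity
  have e2 : (2 : ℝ) ^ j = ((2 : ℝ) ^ (47 : ℕ)) ^ ((j : ℝ) / 47) := by
    rw [← Real.rpow_natCast (2 : ℝ) 47, ← Real.rpow_mul (by norm_num : (0 : ℝ) ≤ 2),
      ← Real.rpow_natCast (2 : ℝ) j]
    congr 1; push_cast; ring
  have e3 : (297 / 100 : ℝ) ^ ((30 : ℝ) * j / 47) =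
      ((297 / 100 : ℝ) ^ (30 : ℕ)) ^ ((j : ℝ) / 47) := by
    rw [← Real.rpow_natCast (297 / 100 : ℝ) 30,
      ← Real.rpow_mul (by norm_num : (0 : ℝ) ≤ 297 / 100)]
    congr 1; push_cast; ring
  rw [e2, e3]
  exact Real.rpow_le_rpow (by positivity) h47 hj0

/-! ## The rung -/

/-- **Base `2.97`**: there is `C` such that for every `t ∈ [0, 1)` some `r ∈ [1, C · (297/100)^{1/(1−t)}]`
has `ω(1, t, r) ≤ 1 + r` — the STAGE-2 twin family read with the sharper growth comparison
`r_{j+1} ≤ 2^{j+2} ≤ r_{1000} · (297/100)^{1/(1−t_j)}`.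
[cite: CoppersmithWinograd1990, §8] [cite: AlmanDuanVassilevskaWilliamsXuXuZhou2025, Thm. 3.2, §3.4] -/
theorem saturationBase_297 :
    ∃ C : ℝ, ∀ t : ℝ, 0 ≤ t → t < 1 →
      ∃ r : ℝ, 1 ≤ r ∧ r ≤ C * (297 / 100 : ℝ) ^ (1 / (1 - t)) ∧ omegaRect ℂ 1 t r ≤ 1 + r := by
  refine ⟨fR 1000, baseSaturation_of_certificates (297 / 100) (fR 1000) (by norm_num)
    (fun k => fT (1000 + k)) (fun k => fR (1000 + k)) (fun k => one_le_fR (1000 + k) (by omega))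
    (fun k => ?_) (fun s hs => ?_) ?_ (fun k => ?_)⟩
  · -- each member is an exact certificate (`familyX`, `familyY` landed)
    exact omegaRect_one_tw_exact (1000 + k) (fN₁ (1000 + k)) (fN₂ (1000 + k)) (fN₃ (1000 + k))
      (fN₄ (1000 + k)) 0 (fN₆ (1000 + k)) (by unfold fN₆; omega)
      (fN₁_add_fN₄ (1000 + k) (by omega)) (fN₂_add_fN₃ (1000 + k) (by omega))
      (by unfold fN₃; positivity) (familyX (1000 + k) (by omega)) (familyY (1000 + k) (by omega))
  · -- the abscissae exhaust `[0,1)`: `1 − t_j ≤ 2/j`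
    obtain ⟨k, hk⟩ := exists_nat_ge (2 / (1 - s))
    refine ⟨k, ?_⟩
    have h1s : 0 < 1 - s := by linarith
    have hjpos : (0 : ℝ) < ((1000 + k : ℕ) : ℝ) := by positivity
    have hle := one_sub_fT_le (1000 + k) (by omega)
    have hk' : 2 / (1 - s) ≤ ((1000 + k : ℕ) : ℝ) := hk.trans (by push_cast; linarith)
    have h2 : 2 / ((1000 + k : ℕ) : ℝ) ≤ 1 - s := by
      rw [div_le_iff₀ hjpos]
      have := (div_le_iff₀ h1s).1 hk'
      linarith
    show s ≤ fT (1000 + k)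
    linarith
  · -- `r_1000 ≤ (297/100) · r_1000`
    show fR (1000 + 0) ≤ 297 / 100 * fR 1000
    rw [add_zero]
    linarith [one_le_fR 1000 (by norm_num)]
  · -- growth: `r_{j+1} ≤ 2^{j+2} = 4 · 2^j ≤ r_1000 · (297/100)^{1/(1−t_j)}`
    show fR (1000 + (k + 1)) ≤ fR 1000 * (297 / 100 : ℝ) ^ (1 / (1 - fT (1000 + k)))
    have h1 := fR_le (1000 + (k + 1)) (by omega)
    have h2 := two_pow_le_rpow_297 (1000 + k)
    have h3 := four_le_fR 1000 (by norm_num)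
    have e : (2 : ℝ) ^ (1000 + (k + 1) + 1) = 4 * (2 : ℝ) ^ (1000 + k) := by
      rw [show 1000 + (k + 1) + 1 = (1000 + k) + 2 from by omega, pow_add, mul_comm]
      norm_num
    rw [e] at h1
    have h4 : (0 : ℝ) ≤ (2 : ℝ) ^ (1000 + k) := by positivity
    exact h1.trans (mul_le_mul h3 h2 h4 (by linarith))

/-- **`SubThreeSaturation`** (route `SaturationLadder`, aside stmt-MatrixMultiplication-32679): some base
`0 < θ < 3` (here `θ = 297/100`) and constant `C` have, for every `t ∈ [0, 1)`, an
`r ∈ [1, C · θ^{1/(1−t)}]` with `ω(1, t, r) ≤ 1 + r`.  The theorem frontier of the base ladder of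
`SubexpSaturation` (stmt-25909: every base `θ > 1`) thus stands at `2.97 < 3 < 4`.
[cite: CoppersmithWinograd1990, §8] [cite: AlmanDuanVassilevskaWilliamsXuXuZhou2025, Thm. 3.2, §3.4] -/
theorem subThreeSaturation : SubThreeSaturation := by
  obtain ⟨C, hC⟩ := saturationBase_297
  exact ⟨297 / 100, by norm_num, by norm_num, C, hC⟩

/-- The twin rung is the special case `θ = 3` of the sub-three rung (sanity link; `TwinSaturation` is
already a theorem, `twinSaturation`). [folklore] -/
theorem twinSaturation_of_subThree (h : SubThreeSaturation) : TwinSaturation := by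
  obtain ⟨θ, hθ0, hθ3, C, hC⟩ := h
  -- `C ≥ 0` unless the statement is vacuous at `t = 0`
  obtain ⟨r0, hr0, hr0C, -⟩ := hC 0 le_rfl one_pos
  have hC0 : 0 ≤ C := by
    have hpow : 0 < θ ^ (1 / (1 - (0 : ℝ))) := Real.rpow_pos_of_pos hθ0 _
    by_contra hneg
    rw [not_le] at hneg
    have : C * θ ^ (1 / (1 - (0 : ℝ))) < 0 := mul_neg_of_neg_of_pos hneg hpow
    linarith
  refine ⟨C, fun t ht0 ht1 => ?_⟩
  obtain ⟨r, hr1, hrC, hsat⟩ := hC t ht0 ht1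
  refine ⟨r, hr1, hrC.trans (mul_le_mul_of_nonneg_left ?_ hC0), hsat⟩
  have h1t : 0 ≤ 1 / (1 - t) := by
    have : 0 < 1 - t := by linarith
    positivity
  exact Real.rpow_le_rpow hθ0.le hθ3.le h1t

end Summit.MatrixMultiplication.MatrixMultiplication.Theorems.SaturationLadderSubThreeSaturation

end
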